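import Literature.AlgebraicGeometry.HodgeTheory.BettiUniverseAxioms
import Literature.AlgebraicGeometry.Motives.HodgeStructureStrictProofs
import Literature.AlgebraicGeometry.Motives.HodgeStructureK3TypeProofs
import Literature.AlgebraicTopology.SingularHomology.FiniteDeckTransferPullback
import HarnessLib

/-!
# The transfer of a finite Galois cover of smooth projective varieties is a morphism of Hodge structures

Layer `Literature/AlgebraicGeometry/HodgeTheory`; THEOREMS ONLY — no definition, no named fact, sorry-free
(D-0026).  Joins the tree's transfer of a finite regular covering
(`AlgebraicTopology/SingularHomology/FiniteDeckTransfer(Pullback)`: `τ^* : Hᵏ(E; R) → Hᵏ(B; R)`,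
`τ^* p^* = |G|`, `p^* τ^* = Σ_{g ∈ G} g^*` — Hatcher §3.G) to the Hodge structures of record
`BettiUniverse.hodge hHD hX k` on `Hᵏ(X(ℂ); ℚ)` (`HodgeTheory/BettiUniverseAxioms`: pull-backs are
morphisms of Hodge structures, `BettiUniverse.pull_hodge`, Voisin I §7.3.2).  Written for the cell
`pub-hodgecm2` (COR-CM; route R-A, whose Matsushima–Hecke dictionary wants Hecke correspondences acting on
`H¹(X_Γ(ℂ); ℚ)` by HODGE ENDOMORPHISMS; and the tree's `ShimuraVarieties/HeckeCorrespondenceAction`, which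
presents `T_g = [Γ' : N]⁻¹ · τ_N ∘ (π_g^N)^*` on a Galois level cover and lists «compatibility with Hodge
types» among the properties NOT proved there).  Count-neutral.

## The mathematics

Let `f : X ⟶ Y` be a morphism of smooth projective complex varieties such that `f(ℂ) : X(ℂ) → Y(ℂ)` is a
finite REGULAR (Galois) covering with deck group `G` acting through algebraic automorphisms
`φ g : X ⟶ X` — a `FiniteDeckCover G X(ℂ) Y(ℂ)` `c` with `c.proj = f(ℂ)` and `c.deck g = (φ g)(ℂ)`.  Then

* `f^*` is injective on `Hᵏ(Y(ℂ); ℚ)` (`τ^* f^* = |G|`, Hatcher Prop. 3G.1) — `pull_injective_of_finiteDeckCover`;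
* `f^* ∘ τ^* = Σ_g (φ g)^*` (`pull_comp_transferMap_eq_sum`), so for `z ∈ Fᵖ Hᵏ(X)`:
  `f^*_ℂ (τ^*_ℂ z) = Σ_g (φ g)^*_ℂ z ∈ Fᵖ Hᵏ(X)`; since `f^*` is an injective MORPHISM of Hodge structures
  it is STRICT (`F^p Hᵏ(Y) = (f^*_ℂ)⁻¹ F^p Hᵏ(X)`, Deligne, Hodge II, 2.3.5; tree
  `HodgeStructure.strict_holds`), whence `τ^*_ℂ z ∈ Fᵖ Hᵏ(Y)`: **the transfer `τ^*` is a morphism of the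
  Hodge structures of record** (`transferMap_hodge`, `exists_hom_toLinearMap_eq_transferMap`) — the
  classical «`f_*` of a finite étale cover is a morphism of Hodge structures», for Galois covers, on the
  tree's carriers;
* consequently every HECKE-SHAPED operator `τ^* ∘ f₂^* : Hᵏ(Y(ℂ); ℚ) → Hᵏ(Y(ℂ); ℚ)` (`f₂ : X ⟶ Y` any
  morphism — the second projection of a correspondence `Y ← X → Y`) is a Hodge endomorphism, i.e. lies in
  `End_Hdg(Hᵏ(Y(ℂ); ℚ)) = (BettiUniverse.hodge hHD hY k).endAlg` (`transferMap_comp_pull_mem_endAlg`) —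
  the hypothesis `hH : ∀ a, act a ∈ H.endAlg` of the semisimplicity door
  `Motives.HodgeStructure.Polarization.isSemisimple_apply` for algebras generated by such operators.

`hHD`, `hI` are the tree theorems `exists_isReal_hodgeModel_holds`, `hodgePQ_independent_of_hodgeModel_holds`,
kept as arguments as everywhere in the Betti universe.

## Sources

* A. Hatcher, *Algebraic Topology* (2002), §3.G p. 321 (transfer; `π^♯ τ = n`), Prop. 3G.1 (`π^*` injective with
  coefficients in a field of characteristic `0`).
* C. Voisin, *Hodge Theory and Complex Algebraic Geometry I* (2002), §7.3.2 (morphisms of Hodge structures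
  induced by holomorphic maps: `φ^*`, and the Gysin morphism `φ_*`).
* P. Deligne, *Théorie de Hodge II*, Publ. Math. IHÉS 40 (1971), Thm. 2.3.5 (iii) (morphisms of Hodge
  structures are strict).
* G. Shimura, *Introduction to the Arithmetic Theory of Automorphic Functions* (1971), §8.3 (8.3.1)–(8.3.2)
  (action of double cosets on cohomology: restriction, conjugation, transfer).

## References

* [HatcherAT2002] A. Hatcher, Algebraic Topology, CUP 2002, §3.G p. 321 and Prop. 3G.1.
* [VoisinHodgeI2002] C. Voisin, Hodge Theory and Complex Algebraic Geometry I, CUP 2002, §7.3.2.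
* [DeligneHodgeII1971] P. Deligne, Théorie de Hodge II, Publ. Math. IHÉS 40 (1971), Thm. 2.3.5.
-/

noncomputable section

open scoped TensorProduct
open CategoryTheory

namespace Literature.AlgebraicGeometry.HodgeTheory

namespace BettiUniverse

open Literature.AlgebraicGeometry.Motives Literature.AlgebraicTopology.SingularHomology
open Literature.AlgebraicGeometry.Motives.HodgeStructure

variable {n m : ℕ} {X Y : Motives.SchemeOver ℂ}
variable {G : Type} [Group G] [Fintype G] [MulAction G (ComplexPoints X)]

/-! ### §1 The algebraic Galois cover: `f^*` injective, `f^* ∘ τ^* = Σ_g (φ g)^*` -/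

/-- **`f^*` is injective on `Hᵏ(Y(ℂ); ℚ)` for a finite Galois cover `f(ℂ) : X(ℂ) → Y(ℂ)`**: a class killed
by `f^*` is `|G|`-torsion (`FiniteDeckCover.card_smul_eq_zero_of_map_eq_zero`, i.e. `τ^* f^* = |G|`), hence
zero over `ℚ` (Hatcher Prop. 3G.1). [cite: HatcherAT2002, §3.G Prop. 3G.1] -/
theorem pull_injective_of_finiteDeckCover (c : FiniteDeckCover G (ComplexPoints X) (ComplexPoints Y))
    (f : X ⟶ Y) (hf : c.proj = AlgPoints.mapContinuous (L := ℂ) f) (k : ℕ) :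
    Function.Injective (pull f k) := by
  refine (injective_iff_map_eq_zero _).2 fun x hx => ?_
  have hx' : singularCohomology.map ℚ ℚ c.proj k x = 0 := by rw [hf]; exact hx
  have h := c.card_smul_eq_zero_of_map_eq_zero (R := ℚ) k hx'
  rw [← Nat.cast_smul_eq_nsmul ℚ] at h
  exact (smul_eq_zero.1 h).resolve_left (Nat.cast_ne_zero.2 Fintype.card_ne_zero)

/-- **`f^*(τ^* y) = Σ_{g ∈ G} (φ g)^* y`** on `Hᵏ(X(ℂ); ℚ)`, when the deck transformations of the Galois
cover `f(ℂ)` are the complex points of algebraic automorphisms `φ g : X ⟶ X` (Hatcher §3.G read upstairs,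
tree `FiniteDeckCover.map_proj_transferMap`). [cite: HatcherAT2002, §3.G p. 321] -/
theorem pull_transferMap_eq_sum (c : FiniteDeckCover G (ComplexPoints X) (ComplexPoints Y))
    (f : X ⟶ Y) (hf : c.proj = AlgPoints.mapContinuous (L := ℂ) f)
    (φ : G → (X ⟶ X)) (hφ : ∀ g, c.deck g = AlgPoints.mapContinuous (L := ℂ) (φ g)) (k : ℕ)
    (y : bettiCohomology X k) :
    pull f k ((c.transferMap (R := ℚ) k).hom y) = ∑ g, pull (φ g) k y := by
  have h := c.map_proj_transferMap (R := ℚ) k y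
  rw [hf] at h
  simp_rw [hφ] at h
  exact h

/-- The same as an identity of `ℚ`-linear maps: `f^* ∘ τ^* = Σ_g (φ g)^*`. [cite: HatcherAT2002, §3.G p. 321] -/
theorem pull_comp_transferMap_eq_sum (c : FiniteDeckCover G (ComplexPoints X) (ComplexPoints Y))
    (f : X ⟶ Y) (hf : c.proj = AlgPoints.mapContinuous (L := ℂ) f)
    (φ : G → (X ⟶ X)) (hφ : ∀ g, c.deck g = AlgPoints.mapContinuous (L := ℂ) (φ g)) (k : ℕ) :
    pull f k ∘ₗ (c.transferMap (R := ℚ) k).hom = ∑ g, pull (φ g) k := by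
  refine LinearMap.ext fun y => ?_
  rw [LinearMap.comp_apply, pull_transferMap_eq_sum c f hf φ hφ k y, LinearMap.sum_apply]

/-- Complexified form: `f^*_ℂ (τ^*_ℂ z) = Σ_g (φ g)^*_ℂ z` on `ℂ ⊗_ℚ Hᵏ(X(ℂ); ℚ)`. [cite: HatcherAT2002, §3.G p. 321] -/
theorem pull_baseChange_transferMap_baseChange (c : FiniteDeckCover G (ComplexPoints X) (ComplexPoints Y))
    (f : X ⟶ Y) (hf : c.proj = AlgPoints.mapContinuous (L := ℂ) f)
    (φ : G → (X ⟶ X)) (hφ : ∀ g, c.deck g = AlgPoints.mapContinuous (L := ℂ) (φ g)) (k : ℕ)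
    (z : ℂ ⊗[ℚ] bettiCohomology X k) :
    (pull f k).baseChange ℂ (((c.transferMap (R := ℚ) k).hom).baseChange ℂ z) =
      ∑ g, (pull (φ g) k).baseChange ℂ z := by
  have hsum : (∑ g, pull (φ g) k).baseChange ℂ = ∑ g, (pull (φ g) k).baseChange ℂ := by
    have h := map_sum (LinearMap.baseChangeHom ℚ ℂ (bettiCohomology X k) (bettiCohomology X k))
      (fun g => pull (φ g) k) Finset.univ
    simpa only [LinearMap.baseChangeHom_apply] using h
  rw [← LinearMap.comp_apply, ← LinearMap.baseChange_comp, pull_comp_transferMap_eq_sum c f hf φ hφ k,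
    hsum, LinearMap.sum_apply]

/-! ### §2 The transfer is a morphism of the Hodge structures of record -/

/-- **The transfer of a finite Galois cover of smooth projective varieties preserves the Hodge
filtration**: `τ^*_ℂ (Fᵖ Hᵏ(X)) ⊆ Fᵖ Hᵏ(Y)` for `f : X ⟶ Y` with `f(ℂ)` a finite regular covering whose
deck transformations are algebraic.  Proof: `f^*_ℂ (τ^*_ℂ z) = Σ_g (φ g)^*_ℂ z ∈ Fᵖ Hᵏ(X)` for
`z ∈ Fᵖ Hᵏ(X)` (pull-backs are morphisms of Hodge structures, Voisin §7.3.2); `f^*` is a morphism of Hodge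
structures, hence STRICT (Deligne, Hodge II, 2.3.5: `f^*_ℂ(Fᵖ Hᵏ(Y)) = Fᵖ Hᵏ(X) ∩ im f^*_ℂ`), and injective
(Hatcher Prop. 3G.1), so `τ^*_ℂ z ∈ Fᵖ Hᵏ(Y)`.  (For a finite étale `f`, `τ^* = f_*` up to the number of
sheets: Voisin's «Gysin morphism is a morphism of Hodge structures», here in bidegree `(0,0)`.)
[cite: VoisinHodgeI2002, §7.3.2] [cite: DeligneHodgeII1971, Thm. 2.3.5(iii)] [cite: HatcherAT2002, §3.G Prop. 3G.1] -/
theorem transferMap_hodge (hHD : exists_isReal_hodgeModel) (hI : hodgePQ_independent_of_hodgeModel)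
    (hX : Motives.IsSmoothProjective n X) (hY : Motives.IsSmoothProjective m Y)
    (c : FiniteDeckCover G (ComplexPoints X) (ComplexPoints Y))
    (f : X ⟶ Y) (hf : c.proj = AlgPoints.mapContinuous (L := ℂ) f)
    (φ : G → (X ⟶ X)) (hφ : ∀ g, c.deck g = AlgPoints.mapContinuous (L := ℂ) (φ g)) (k : ℕ) (p : ℤ) :
    ((hodge hHD hX k).F p).map (((c.transferMap (R := ℚ) k).hom).baseChange ℂ) ≤ (hodge hHD hY k).F p := by
  rintro _ ⟨z, hz, rfl⟩
  -- `f^*_ℂ (τ^*_ℂ z) ∈ Fᵖ Hᵏ(X)`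
  have h1 : (pull f k).baseChange ℂ (((c.transferMap (R := ℚ) k).hom).baseChange ℂ z) ∈
      (hodge hHD hX k).F p := by
    rw [pull_baseChange_transferMap_baseChange c f hf φ hφ k z]
    exact Submodule.sum_mem _ fun g _ => pull_hodge hHD hI hX hX (φ g) k p ⟨z, hz, rfl⟩
  -- strictness of the Hodge morphism `f^*`
  have h2 : (pull f k).baseChange ℂ (((c.transferMap (R := ℚ) k).hom).baseChange ℂ z) ∈
      ((hodge hHD hY k).F p).map ((pull f k).baseChange ℂ) := by
    have hs := Hom.strict_holds (pullHodgeHom hHD hI hX hY f k) p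
    rw [pullHodgeHom_toLinearMap] at hs
    rw [hs]
    exact ⟨h1, _, rfl⟩
  obtain ⟨w, hw, hwe⟩ := h2
  have hinj : Function.Injective ((pull f k).baseChange ℂ) :=
    baseChange_injective_of_injective (pull_injective_of_finiteDeckCover c f hf k)
  rw [← hinj hwe]
  exact hw

/-- **The transfer is (the linear map of) a morphism of Hodge structures** `Hᵏ(X) → Hᵏ(Y)` between the
Hodge structures of record. [cite: VoisinHodgeI2002, §7.3.2] [cite: DeligneHodgeII1971, Thm. 2.3.5(iii)] -/
theorem exists_hom_toLinearMap_eq_transferMap (hHD : exists_isReal_hodgeModel)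
    (hI : hodgePQ_independent_of_hodgeModel)
    (hX : Motives.IsSmoothProjective n X) (hY : Motives.IsSmoothProjective m Y)
    (c : FiniteDeckCover G (ComplexPoints X) (ComplexPoints Y))
    (f : X ⟶ Y) (hf : c.proj = AlgPoints.mapContinuous (L := ℂ) f)
    (φ : G → (X ⟶ X)) (hφ : ∀ g, c.deck g = AlgPoints.mapContinuous (L := ℂ) (φ g)) (k : ℕ) :
    ∃ T : Hom (hodge hHD hX k) (hodge hHD hY k), T.toLinearMap = (c.transferMap (R := ℚ) k).hom :=
  ⟨⟨(c.transferMap (R := ℚ) k).hom, transferMap_hodge hHD hI hX hY c f hf φ hφ k⟩, rfl⟩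

/-! ### §3 Hecke-shaped operators `τ^* ∘ f₂^*` are Hodge endomorphisms -/

/-- **Correspondence operators `τ^* ∘ f₂^*` are Hodge endomorphisms of `Hᵏ(Y(ℂ); ℚ)`**: for the Galois
cover `f : X ⟶ Y` as above and ANY morphism `f₂ : X ⟶ Y` (the second leg of the correspondence
`Y ←f– X –f₂→ Y`; for a Hecke correspondence `f₂ = f ∘ [g]`), the operator `τ_f^* ∘ f₂^*` preserves the Hodge
filtration of record, i.e. lies in `End_Hdg(Hᵏ(Y(ℂ); ℚ))` — Shimura's «action of double cosets on the
cohomology group» (restriction, conjugation, transfer) is by Hodge endomorphisms.  This is the hypothesis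
`hH` of `Motives.HodgeStructure.Polarization.isSemisimple_apply` for algebras generated by such operators.
[cite: VoisinHodgeI2002, §7.3.2] [cite: HatcherAT2002, §3.G p. 321] -/
theorem transferMap_comp_pull_mem_endAlg (hHD : exists_isReal_hodgeModel)
    (hI : hodgePQ_independent_of_hodgeModel)
    (hX : Motives.IsSmoothProjective n X) (hY : Motives.IsSmoothProjective m Y)
    (c : FiniteDeckCover G (ComplexPoints X) (ComplexPoints Y))
    (f : X ⟶ Y) (hf : c.proj = AlgPoints.mapContinuous (L := ℂ) f)
    (φ : G → (X ⟶ X)) (hφ : ∀ g, c.deck g = AlgPoints.mapContinuous (L := ℂ) (φ g)) (k : ℕ)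
    (f₂ : X ⟶ Y) :
    (c.transferMap (R := ℚ) k).hom ∘ₗ pull f₂ k ∈ (hodge hHD hY k).endAlg := by
  intro p
  rw [LinearMap.baseChange_comp, Submodule.map_comp]
  exact (Submodule.map_mono (pull_hodge hHD hI hX hY f₂ k p)).trans
    (transferMap_hodge hHD hI hX hY c f hf φ hφ k p)

/-- **`ℚ`-linear combinations of correspondence operators are Hodge endomorphisms**: for a family of
Galois covers `fᵢ : Xᵢ ⟶ Y` (deck data `cᵢ`, algebraic deck transformations `φᵢ`) and second legs
`f₂ᵢ : Xᵢ ⟶ Y`, every `Σᵢ rᵢ · τᵢ^* ∘ f₂ᵢ^*` lies in `End_Hdg(Hᵏ(Y(ℂ); ℚ))` (`endAlg` is a subalgebra) — the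
shape of a Hecke algebra element `Σ r_g T_g`. [cite: VoisinHodgeI2002, §7.3.2] [cite: HatcherAT2002, §3.G p. 321] -/
theorem sum_smul_transferMap_comp_pull_mem_endAlg (hHD : exists_isReal_hodgeModel)
    (hI : hodgePQ_independent_of_hodgeModel) (hY : Motives.IsSmoothProjective m Y) (k : ℕ)
    {ι : Type*} (s : Finset ι) (r : ι → ℚ)
    (Xs : ι → Motives.SchemeOver ℂ) (ns : ι → ℕ) (hXs : ∀ i, Motives.IsSmoothProjective (ns i) (Xs i))
    (Gs : ι → Type) [∀ i, Group (Gs i)] [∀ i, Fintype (Gs i)] [∀ i, MulAction (Gs i) (ComplexPoints (Xs i))]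
    (cs : ∀ i, FiniteDeckCover (Gs i) (ComplexPoints (Xs i)) (ComplexPoints Y))
    (fs : ∀ i, Xs i ⟶ Y) (hfs : ∀ i, (cs i).proj = AlgPoints.mapContinuous (L := ℂ) (fs i))
    (φs : ∀ i, Gs i → (Xs i ⟶ Xs i))
    (hφs : ∀ i g, (cs i).deck g = AlgPoints.mapContinuous (L := ℂ) (φs i g))
    (f₂s : ∀ i, Xs i ⟶ Y) :
    ∑ i ∈ s, r i • (((cs i).transferMap (R := ℚ) k).hom ∘ₗ pull (f₂s i) k) ∈ (hodge hHD hY k).endAlg :=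
  Subalgebra.sum_mem _ fun i _ => Subalgebra.smul_mem _
    (transferMap_comp_pull_mem_endAlg hHD hI (hXs i) hY (cs i) (fs i) (hfs i) (φs i) (hφs i) k (f₂s i))
    (r i)

end BettiUniverse

end Literature.AlgebraicGeometry.HodgeTheory

end
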